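import Literature.MathematicalPhysics.QuantumFieldTheory.Balaban1983to89.B6Ineq243HolderDualTwoLevelBox
import Literature.MathematicalPhysics.QuantumFieldTheory.Balaban1983to89.B4Thm19ZeroBoxHolderDualMeshOne

/-!
# `Balaban1983to89.B6Prop22DualHolderTwoLevelBoxRateUnifL0` — the LEVEL-0 TWIN of `B6Prop22DualHolderTwoLevelBoxRateUnif`: the column («dual») Hölder cube input of entry 5 of (2.67) in the printed quantifier order `∃ δ′ ∀ α ∃ c′(α)` for the genuine two-level cube propagator
# `G′(□)` at EVERY mesh `L^{−j}`, `j ≥ 0` (the binder «1 ≤ k» of the original removed), so that the `(0, 1)` two-level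
# cubes of a nested family WITH LEVEL 0 (`Λ₀ = T ∖ Ω₁ ≠ ∅`) are covered

statement-level skeleton of published theorems with citation tags; proofs where landed; nothing here is a claim about the Yang–Mills mass gap

Source: T. Bałaban, *Propagators and renormalization transformations for lattice gauge theories. II*, Commun. Math.
Phys. **96** (1984) 223–250 [`Balaban1984PropagatorsII`, "B6"], p. 225 [PDF 3] (2.14) (the index `j` running from `0`),
p. 229 [PDF 7] «Taking these covers for all j from 0 to k we get a family 𝔇 of cubes □», p. 230 [PDF 8] (2.40)–(2.44),
p. 234 [PDF 12] Proposition 2.2 (2.67); T. Bałaban, *Regularity and decay of lattice Green's functions*, Commun. Math.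
Phys. **89** (1983) 571–597 [`Balaban1983RegularityDecay`, "[3]" of B6] — Theorem (1.9)/(1.10), Lemma 2.2 (2.17),
Lemma 2.4 (2.35)–(2.36) «for arbitrary non-negative integer j», as PROVED at `A = 0` for boxes at every mesh `k ≥ 0`
in `B4Thm110ZeroBoxMeshOne`, `B4Thm19ZeroBoxHolderMeshOne`, `B4Thm19ZeroBoxHolderDualMeshOne`.

## WHY THIS FILE (row G-F3′-L0 of the lit-balaban cell, packet S-B of `lit-balaban-r03/G-F3L0-PLAN.md` §5)

`B6Prop22DualHolderTwoLevelBoxRateUnif` states its estimate(s) (§1 `ineq243_twoLevel_holderDual_wsum2_unif` (the cube input consumed by the multi-level lane; its §§2ff. two-level Prop. 2.2 assembly is NOT twinned here)) with the binder `∀ k, 1 ≤ k →` inherited from the [3] box theorems as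
typed for «k … an arbitrary positive integer» (B4 p. 572).  In a nested family WITH LEVEL 0 (plan §1: level 0 = the
index `j = 0` of (2.14)/(2.19)–(2.20) with a finite lattice-scale weight, `Q′₀ = Q₀ = id`) the cubes meeting `Λ₀` and
`Λ₁` carry the two-level operator at mesh `L^{−0} = 1`: the `k = 0` member of the SAME matrix family
`twoLevelOp`/`gTwoLevel` (`n = 1`), whose inversion and deterministic assembly lemmas are mesh-free (`hn : 1 ≤ n`).
Only the [3] inputs carried `1 ≤ k`; their all-scales forms now exist.  PORT DISCIPLINE (plan §4): SAME declaration
names and binder order in the namespace `…B6Prop22DualHolderTwoLevelBoxRateUnifL0`, the binder `1 ≤ k →` deleted, proofs = the original assembly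
VERBATIM over the `_all` inputs, every mesh-free declaration of the original used BY NAME (nothing restated or edited).

## HONEST SCOPE

Exactly that of `B6Prop22DualHolderTwoLevelBoxRateUnif` (its header, HONEST SCOPE and DICTIONARY apply verbatim), plus: the `k = 0` member is the
unit-mesh two-level cube (level `j = 0` = points, level `1` = `L`-blocks, weights `a_j`, `a_{j+1} = aNext ℓ a_j a`);
whether a given nested family uses this member with these weights is the consumer's reading of (2.14) at `j = 0` (plan
§1, OWNER-confirmed), not a claim of this file; constants are `min`/`max`-merges of the `k ≥ 1` and `k = 0` constants.

Value = kernel certificate (level-0-capable cube inputs of [B6] Prop. 2.2 (2.67)), NOT summit progress: the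
Yang–Mills / `Summit.QuantumFields` statements are untouched; no Literature fact is minted.
-/

namespace Literature.MathematicalPhysics.QuantumFieldTheory.Balaban1983to89.B6Prop22DualHolderTwoLevelBoxRateUnifL0

open Finset Matrix
open Literature.MathematicalPhysics.QuantumFieldTheory.Balaban1983to89.B4ContourShift
open Literature.MathematicalPhysics.QuantumFieldTheory.Balaban1983to89.B4Reflection242
open Literature.MathematicalPhysics.QuantumFieldTheory.Balaban1983to89.B4Green242Bridge
open Literature.MathematicalPhysics.QuantumFieldTheory.Balaban1983to89.B4BoxCov237
open Literature.MathematicalPhysics.QuantumFieldTheory.Balaban1983to89.B4Thm110ZeroBox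
open Literature.MathematicalPhysics.QuantumFieldTheory.Balaban1983to89.B4Thm110ZeroBoxDeriv
open Literature.MathematicalPhysics.QuantumFieldTheory.Balaban1983to89.B4Thm19ZeroBoxHolder
open Literature.MathematicalPhysics.QuantumFieldTheory.Balaban1983to89.B4Lemma22ZeroBoxDerivDual (fwd fwd_eq_of_nbr)
open Literature.MathematicalPhysics.QuantumFieldTheory.Balaban1983to89.B4Thm19ZeroBoxHolderDual
open Literature.MathematicalPhysics.QuantumFieldTheory.Balaban1983to89.B4Thm110ZeroBoxMeshOne (thm110_zero_box_roww_coeff_all thm110_zero_box_deriv_roww_coeff_all)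
open Literature.MathematicalPhysics.QuantumFieldTheory.Balaban1983to89.B4Thm19ZeroBoxHolderDualMeshOne (lemma22_zero_box_Gdstar_roww_coeff_all
  thm19Dual_zero_box_roww_coeff_unif_all)
open Literature.MathematicalPhysics.QuantumFieldTheory.Balaban1983to89.B6Ineq243TwoLevelBox
open Literature.MathematicalPhysics.QuantumFieldTheory.Balaban1983to89.B6Ineq243HolderTwoLevelBox (wsum2_vecMul_le)
open Literature.MathematicalPhysics.QuantumFieldTheory.Balaban1983to89.B6Ineq243HolderDualTwoLevelBox
open B4StripSumsHolder (one_le_supNorm)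
open B4Sect5Proof (latticeConst latticeConst_nonneg)

noncomputable section

variable {d : ℕ}

/-! ## §1 The (2.43) column Hölder cube input with one rate for all `α`, at every mesh `j ≥ 0` -/

/-- LEVEL-0 TWIN: the original with the binder «1 ≤ k» removed (inputs = the all-scales `_all` forms of `B4Thm110ZeroBoxMeshOne` / `B4Thm19ZeroBoxHolderMeshOne` / `B4Thm19ZeroBoxHolderDualMeshOne`; the mesh-free assembly lemmas of the original BY NAME). **(2.43) COLUMN («Dual») HÖLDER-WEIGHTED CUBE INPUT FOR THE TWO-LEVEL BOX, RATE UNIFORM IN `α`** — p21's `B6Ineq243HolderDualTwoLevelBox.ineq243_twoLevel_holderDual_wsum2` in print's quantifier order `∃ δ′ ∀ α ∈ [0,1) ∃ c′(α)`; the `α`-dependent input is now `…B4Thm19ZeroBoxHolderDualRateUnif.thm19Dual_zero_box_roww_coeff_unif`, the others are `α`-free. Proof = the original with the `∃`-witnesses reordered. [cite: Balaban1984PropagatorsII, (2.43) p.230, Prop. 2.2 (2.67) p.234 (entry 5); Balaban1983RegularityDecay, Thm (1.9) p.573] -/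
theorem ineq243_twoLevel_holderDual_wsum2_unif (d ℓ : ℕ) (hℓ : 1 ≤ ℓ) (aminus aplus m2plus a2minus a2plus : ℝ)
    (ha : 0 < aminus) (ha2 : 0 < a2minus) :
    ∃ δ' : ℝ, 0 < δ' ∧ ∀ (α : ℝ), 0 ≤ α → α < 1 → ∃ c' : ℝ, 0 < c' ∧ ∀ (k : ℕ) (aj m2 a : ℝ), aminus ≤ aj → aj ≤ aplus → 0 ≤ m2 →
      m2 ≤ m2plus → a2minus ≤ a → a ≤ a2plus → ∀ (M' : Fin (d + 1) → ℕ), (∀ i, 1 ≤ M' i) →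
        ∀ (Λ : Finset ↥(boxDom (fun i => (ℓ + 1) * M' i))) (μ : Fin (d + 1))
          (x x' : ↥(boxDom (fun i => (ℓ + 1) ^ k * ((ℓ + 1) * M' i)))), x'.1 ≠ x.1 →
          ∑ z, |((((ℓ + 1) ^ k : ℕ) : ℝ) / supNorm (x'.1 - x.1)) ^ α * ((((ℓ + 1) ^ k : ℕ) : ℝ)
                * ((gTwoLevel ((ℓ + 1) ^ k) ℓ aj a m2 M' Λ x' (fwd _ μ z) - gTwoLevel ((ℓ + 1) ^ k) ℓ aj a m2 M' Λ x' z)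
                  - (gTwoLevel ((ℓ + 1) ^ k) ℓ aj a m2 M' Λ x (fwd _ μ z)
                    - gTwoLevel ((ℓ + 1) ^ k) ℓ aj a m2 M' Λ x z)))|
              * Real.exp (δ' * min (supNorm (x.1 - z.1)) (supNorm (x'.1 - z.1)) / (((ℓ + 1) ^ k : ℕ) : ℝ))
            ≤ c' := by
  obtain ⟨δ₀, c₀, hδ₀, hc₀, hG⟩ := thm110_zero_box_roww_coeff_all d ℓ hℓ aminus aplus m2plus ha
  obtain ⟨δd, cd, hδd, hcd, hGD⟩ := thm110_zero_box_deriv_roww_coeff_all d ℓ hℓ aminus aplus m2plus ha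
  obtain ⟨δ₂, c₂, hδ₂, hc₂, hG2⟩ := lemma22_zero_box_Gdstar_roww_coeff_all d ℓ hℓ aminus aplus m2plus ha
  obtain ⟨δ₁, hδ₁, hGTA⟩ := thm19Dual_zero_box_roww_coeff_unif_all d ℓ hℓ aminus aplus m2plus ha
  obtain ⟨δ, c, hδ, hc, hC⟩ := cov116_box_finset_decay d ℓ hℓ aminus aplus m2plus a2minus a2plus ha ha2
  -- the common rate
  set δ' : ℝ := min (min (min δ₀ δd) (min δ₁ δ₂)) (δ / 2) with hδ'
  have hδ'pos : 0 < δ' := lt_min (lt_min (lt_min hδ₀ hδd) (lt_min hδ₁ hδ₂)) (half_pos hδ)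
  have hd0 : δ' ≤ δ₀ := (min_le_left _ _).trans ((min_le_left _ _).trans (min_le_left _ _))
  have hdd : δ' ≤ δd := (min_le_left _ _).trans ((min_le_left _ _).trans (min_le_right _ _))
  have hd1 : δ' ≤ δ₁ := (min_le_left _ _).trans ((min_le_right _ _).trans (min_le_left _ _))
  have hd2 : δ' ≤ δ₂ := (min_le_left _ _).trans ((min_le_right _ _).trans (min_le_right _ _))
  have hd3 : δ' ≤ δ / 2 := min_le_right _ _
  have hKn : 0 ≤ latticeConst (d + 1) (δ / 2) := latticeConst_nonneg (d + 1) (half_pos hδ).le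
  set cL : ℝ := 2 * c₀ + ((d : ℝ) + 1) * Real.exp δ' * cd with hcL
  have hcL0 : 0 ≤ cL := by positivity
  refine ⟨δ', hδ'pos, fun α hα0 hα1 => ?_⟩
  obtain ⟨c₁, hc₁, hGT⟩ := hGTA α hα0 hα1
  refine ⟨c₁ + aplus ^ 2 * (cL * ((c * Real.exp δ' * latticeConst (d + 1) (δ / 2)) * c₂)), by positivity, ?_⟩
  intro k aj m2 a h1 h2 h3 h4 h5 h6 M' hM Λ μ x x' hne
  have hn1 : 1 ≤ (ℓ + 1) ^ k := Nat.one_le_pow _ _ (by omega)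
  have hMℓ : ∀ i, 1 ≤ (ℓ + 1) * M' i := fun i => by nlinarith [hM i]
  have haj : 0 < aj := lt_of_lt_of_le ha h1
  -- rows of `G` and of the column-differenced `G`, at the common rate
  have hGz : ∀ z, roww δ' ((ℓ + 1) ^ k) (boxOpR ((ℓ + 1) ^ k) aj m2 (fun i => (ℓ + 1) * M' i))⁻¹ z ≤ c₀ :=
    fun z => (roww_mono hd0 _ _ z).trans (hG k aj m2 h1 h2 h3 h4 (fun i => (ℓ + 1) * M' i) hMℓ z)
  have hGdz : ∀ y, roww δ₂ ((ℓ + 1) ^ k) (Matrix.of fun w z => (((ℓ + 1) ^ k : ℕ) : ℝ) *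
      ((boxOpR ((ℓ + 1) ^ k) aj m2 (fun i => (ℓ + 1) * M' i))⁻¹ w (fwd _ μ z)
        - (boxOpR ((ℓ + 1) ^ k) aj m2 (fun i => (ℓ + 1) * M' i))⁻¹ w z)) y ≤ c₂ := by
    intro y
    have := hG2 k aj m2 h1 h2 h3 h4 (fun i => (ℓ + 1) * M' i) hMℓ μ y
    unfold roww
    simpa only [Matrix.of_apply] using this
  -- the Hölder-weighted long row difference of `G`
  have hdiff : ∀ (i : Fin (d + 1)) (u ue : ↥(boxDom (fun i => (ℓ + 1) ^ k * ((ℓ + 1) * M' i)))),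
      ue.1 = u.1 + Pi.single i 1 →
      wsum δ' ((ℓ + 1) ^ k) u (fun c => (((ℓ + 1) ^ k : ℕ) : ℝ) *
        ((boxOpR ((ℓ + 1) ^ k) aj m2 (fun i => (ℓ + 1) * M' i))⁻¹ ue c
          - (boxOpR ((ℓ + 1) ^ k) aj m2 (fun i => (ℓ + 1) * M' i))⁻¹ u c)) ≤ cd := by
    intro i u ue hue
    refine (wsum_mono hdd _ _ _).trans ?_
    have := hGD k aj m2 h1 h2 h3 h4 (fun i => (ℓ + 1) * M' i) hMℓ i u ue hue
    unfold wsum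
    exact this
  have hLx := wsum2_longRow_holder_le hδ'pos.le hn1 (boxOpR ((ℓ + 1) ^ k) aj m2 (fun i => (ℓ + 1) * M' i))⁻¹
    hc₀.le hcd.le hGz hdiff hα0 hα1.le x x' hne
  -- the column Hölder clause for `G`
  have hGTx : wsum2 δ₁ ((ℓ + 1) ^ k) x x' (fun z => ((((ℓ + 1) ^ k : ℕ) : ℝ) / supNorm (x'.1 - x.1)) ^ α
      * (((((ℓ + 1) ^ k : ℕ)) : ℝ) * (((boxOpR ((ℓ + 1) ^ k) aj m2 (fun i => (ℓ + 1) * M' i))⁻¹ x' (fwd _ μ z)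
        - (boxOpR ((ℓ + 1) ^ k) aj m2 (fun i => (ℓ + 1) * M' i))⁻¹ x' z)
        - ((boxOpR ((ℓ + 1) ^ k) aj m2 (fun i => (ℓ + 1) * M' i))⁻¹ x (fwd _ μ z)
        - (boxOpR ((ℓ + 1) ^ k) aj m2 (fun i => (ℓ + 1) * M' i))⁻¹ x z)))) ≤ c₁ :=
    hGT k aj m2 h1 h2 h3 h4 (fun i => (ℓ + 1) * M' i) hMℓ μ x x' hne
  have hCz := (hC ((ℓ + 1) ^ k) hn1 aj m2 a h1 h2 h3 h4 h5 h6 M' hM Λ).2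
  have hmain := gTwoLevel_holderDual_wsum2_le hn1 aj a m2 Λ μ hc₂.le hc.le hδ hδ'pos.le hd1 hd2 hd3 hGdz hCz
    _ x x' hLx hGTx
  rw [wsum2] at hmain
  refine hmain.trans ?_
  have : aj ^ 2 ≤ aplus ^ 2 := pow_le_pow_left₀ haj.le h2 2
  have h0 : 0 ≤ cL * ((c * Real.exp δ' * latticeConst (d + 1) (δ / 2)) * c₂) := by positivity
  nlinarith

/-! ## §2 Non-vacuity, now for every `k ≥ 0` -/

/-- the hypotheses are inhabited: `d + 1 = 4`, `L = 2`, unit windows (`∃ δ′ ∀ α ∃ c′` form).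
[cite: Balaban1984PropagatorsII, (2.43) p.230] -/
example : ∃ δ' : ℝ, 0 < δ' ∧ ∀ (α : ℝ), 0 ≤ α → α < 1 → ∃ c' : ℝ, 0 < c' ∧ ∀ (k : ℕ) (aj m2 a : ℝ), (1 : ℝ) ≤ aj →
      aj ≤ 1 → 0 ≤ m2 → m2 ≤ 1 → (1 : ℝ) ≤ a → a ≤ 1 → ∀ (M' : Fin (3 + 1) → ℕ), (∀ i, 1 ≤ M' i) →
        ∀ (Λ : Finset ↥(boxDom (fun i => (1 + 1) * M' i))) (μ : Fin (3 + 1))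
          (x x' : ↥(boxDom (fun i => (1 + 1) ^ k * ((1 + 1) * M' i)))), x'.1 ≠ x.1 →
          ∑ z, |((((1 + 1) ^ k : ℕ) : ℝ) / supNorm (x'.1 - x.1)) ^ α * ((((1 + 1) ^ k : ℕ) : ℝ)
                * ((gTwoLevel ((1 + 1) ^ k) 1 aj a m2 M' Λ x' (fwd _ μ z) - gTwoLevel ((1 + 1) ^ k) 1 aj a m2 M' Λ x' z)
                  - (gTwoLevel ((1 + 1) ^ k) 1 aj a m2 M' Λ x (fwd _ μ z)
                    - gTwoLevel ((1 + 1) ^ k) 1 aj a m2 M' Λ x z)))|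
              * Real.exp (δ' * min (supNorm (x.1 - z.1)) (supNorm (x'.1 - z.1)) / (((1 + 1) ^ k : ℕ) : ℝ))
            ≤ c' :=
  ineq243_twoLevel_holderDual_wsum2_unif 3 1 le_rfl 1 1 1 1 1 one_pos one_pos

end

end Literature.MathematicalPhysics.QuantumFieldTheory.Balaban1983to89.B6Prop22DualHolderTwoLevelBoxRateUnifL0
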